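import Summits.QuantumFields.YangMills.Theorems.BalabanUVNodesN19JointLawPriceAbsolutePolynomials

/-!
# YM-DAG node N19 (= NE7 proper) — ABSOLUTELY SUMMABLE POWER SERIES IN THE ℓ¹-NORM `S = Σ_i|x_i|` ARE PRICED BY THEIR WEIGHTED
# COEFFICIENT MASS `Σ_n|c_n|d^{e_n}` AT THE ONE-STRING RATE; the SINGLE FOURIER MODE `cos(ωS)` costs `(cosh(ωd) − 1)·96∕(1 + log r⁻¹)`,
# `sin(ωS)` costs `sinh(ωd)·96∕(1 + log r⁻¹)`, `exp(tS)` costs `(e^{|t|d} − 1)·96∕(1 + log r⁻¹)` for every real `t`; tensor products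
# `∏_i g_i(|x_i|)` of absolutely monotone profiles cost `(∏g_i(1) − ∏g_i(0))·96∕(1 + log r⁻¹)`

Cell `pub-ymgap`, HUMAN RULING D-0062 (Track A) ∕ D-0149 (work-bound push), R141 (C) wider-strategy seat `pub-ymgap-dag-n19-e` (strategy
s3 = ALTERNATIVE CURRENCY), generation g29, module 2 (lineage module 116).  Route `Summits/QuantumFields/YangMills/Theses/BalabanUVNodes.lean`,
cluster item K3⁸ «SpineGivenEndpointR13SepCoPHV» (stmt-QuantumFields-27366); filed `--supports` that item `--as helper` (it proves no registered
stub).  COUNT-NEUTRAL: [folklore] bookkeeping over Mathlib (`Real.hasSum_cos` ∕ `hasSum_sin` ∕ `hasSum_cosh` ∕ `hasSum_sinh`,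
`NormedSpace.expSeries_div_hasSum_exp`, dominated convergence) and the lineage BY NAME — module 115 `…N19JointLawPriceAbsolutePolynomials`
(`abs_integral_l1NormPow_sub_le`: `|∫S^n dP − ∫S^n dQ| ≤ d^n·96∕(1 + log r⁻¹)`, `l1Norm_le_card`), p568465 `…N19JointLawBernstein`
(`integrable_of_continuous_of_cube`), module 67 `…N19JointLawClosedFormAtScheme` (`jointLaw_pushforward`, §4 only) and module 115 §2 (`abs_integral_prodAbsPow_sub_le`, §3); NOT a discharge claim.

CONTEXT (CURRENCY-MAP v7 open item (v′), module 115).  Under uniform mixed-moment closeness `r` (`L = log r⁻¹`) of two laws `P, Q` on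
`[−1,1]^ι` (`d = |ι|`), every power of the ℓ¹-norm is priced at `d^n·96∕(1+L)` (module 115: `(Σ_i|x_i|)^n` is a sum of `d^n` mixed ABSOLUTE
moments, each the profile `|·|` of ONE monomial).  This module passes to the limit: every link `g(s) = Σ_n c_n s^{e_n}` with
`M := Σ_n|c_n|d^{e_n} < ∞` — the WIENER CLASS of the disc of radius `d`, restricted to `[0,d]` — is priced at `M·96∕(1+L)`, and the three
classical transcendental links are read off.
§1 ★★ `abs_integral_l1NormGenSeries_partial_sub_le` (partial sums `Σ_{n<N} c_n S^{e_n}`: `(Σ_{n<N}|c_n|d^{e_n})·96∕(1+L)`) ·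
   ★★ `abs_integral_l1NormGenSeries_sub_le` (`|∫Σ'_n c_n S^{e_n} dP − ∫Σ'_n c_n S^{e_n} dQ| ≤ (Σ'_n|c_n|d^{e_n})·96∕(1+L)` whenever the weighted mass
   is summable; the partial sums converge dominatedly by `M` on the cube).
§2 THE SINGLE FOURIER MODE AND ITS RELATIVES (`ω, t` real): ★★ `abs_integral_cos_l1Norm_sub_le` (`cos(ωS)`: `(cosh(ωd) − 1)·96∕(1+L)`, `ω ≥ 0`;
   the series of `cos(ωS) − 1`, mass `cosh(ωd) − 1`) · ★ `abs_integral_sin_l1Norm_sub_le` (`sin(ωS)`: `sinh(ωd)·96∕(1+L)`, `ω ≥ 0`) ·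
   ★ `abs_integral_exp_l1Norm_sub_le_of_real` (`exp(tS)`, ANY real `t`: `(e^{|t|d} − 1)·96∕(1+L)` — module 115 §5 had `t ≥ 0`).
§3 ★★ `abs_integral_prodAbsProfile_sub_le`: TENSOR PRODUCTS `∏_i g_i(|x_i|)` of absolutely monotone polynomial profiles (nonnegative coefficients)
   cost `(∏_i g_i(1) − ∏_i g_i(0))·96∕(1+L)` — their own oscillation times the one-string rate, e.g. `∏_i(1 + |x_i|)∕2` at `(1 − 2^{−d})·96∕(1+L)`;
   module 65's tensor scheme prices such a product of `d` kinked factors at `≍ d²∕L`.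
§4 AT THE SCHEME (module 67's `jointLaw_pushforward` BY NAME, CONDITIONAL on the uniform `Target`): `abs_integral_cos_l1Norm_sub_jointLaw_le_of_uniformTarget` ·
   `abs_integral_prodAbsProfile_sub_jointLaw_le_of_uniformTarget`.
READING for N19 and for the open item (v′) (honest).  The single mode `cos(ω·Σ_i|∏os_i|)` of `d` strings — THE test object of the
numerical study in CURRENCY-MAP v7 — converges under the uniform target at the ONE-string rate times `cosh(ωd) − 1` (`≈ (ωd)²∕2` for `ωd ≤ 1`,
`≈ e^{ωd}∕2` beyond): for `ωd = O(1)` the single mode is a one-string-rate object (below the ridge rate `dω∕L` when `ωd ≤ 1`); the bound is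
non-trivial while `ωd ≲ log L` and beats module 111's `dω∕√L` (nesting) while `ωd ≲ ½ log L`; numerics∕OPEN-PROBLEM.md had the single mode
proved for `kω ≤ 1` only.  The regime `ωd ≫ log L` (most of the single-mode law `ψ(kω∕t)`) stays OPEN: there the weighted mass is
exponentially larger than the oscillation.

HONEST FRAMING (binding).  Elementary and [folklore]; ONE-SIDED (upper bounds); TOY laws; NO consumer in the DAG today (an optimality map of the
seat's own currency); nothing of Bałaban's instantiated; NE7 NOT PRINTED, NOT proved; N19 NOT discharged; count-neutral.  One finite `T⁴`
programme at fixed `ε`; nothing continuum ∕ `ℝ⁴` ∕ OS ∕ mass-gap ∕ Clay.  0 `def` ∕ 0 `sorry`.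
-/

noncomputable section

open Real Finset MeasureTheory Filter Topology

namespace Summit.QuantumFields.YangMills.Theorems.BalabanUVNodesN19JointLawPriceAbsolutePowerSeries

open Summit.QuantumFields.YangMills.Theorems.BalabanUVNodesN19JointLawPriceAbsolutePolynomials
  (abs_integral_l1NormPow_sub_le l1Norm_le_card)
open Summit.QuantumFields.YangMills.Theorems.BalabanUVNodesN19JointLawBernstein (integrable_of_continuous_of_cube)

variable {ι : Type*} [Fintype ι]

/-! ## §1 Absolutely summable power series in the ℓ¹-norm [folklore] -/

/-- ★★ **PARTIAL SUMS `Σ_{n<N} c_n S^{e_n}`: `(Σ_{n<N}|c_n|d^{e_n})·96∕(1 + log r⁻¹)`.**  `P, Q` on `[−1,1]^ι` with all mixed moments `r`-close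
(`0 < r ≤ 1`), `d = |ι|`, coefficients `c : ℕ → ℝ`, exponents `e : ℕ → ℕ`.  Module 115's price `d^n·96∕(1+L)` of `S^n`, summed. [folklore] -/
theorem abs_integral_l1NormGenSeries_partial_sub_le {P Q : Measure (ι → ℝ)} [IsProbabilityMeasure P] [IsProbabilityMeasure Q]
    (hP : P (Set.pi Set.univ (fun _ : ι => Set.Icc (-1 : ℝ) 1))ᶜ = 0) (hQ : Q (Set.pi Set.univ (fun _ : ι => Set.Icc (-1 : ℝ) 1))ᶜ = 0)
    {r : ℝ} (hr0 : 0 < r) (hr1 : r ≤ 1)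
    (hmom : ∀ j : ι → ℕ, |∫ x, ∏ i, x i ^ j i ∂P - ∫ x, ∏ i, x i ^ j i ∂Q| ≤ r) (c : ℕ → ℝ) (e : ℕ → ℕ) (N : ℕ) :
    |∫ x, ∑ n ∈ range N, c n * (∑ i, |x i|) ^ e n ∂P - ∫ x, ∑ n ∈ range N, c n * (∑ i, |x i|) ^ e n ∂Q| ≤
      (∑ n ∈ range N, |c n| * (Fintype.card ι : ℝ) ^ e n) * (96 / (1 + Real.log r⁻¹)) := by
  have hcont : ∀ n : ℕ, Continuous fun x : ι → ℝ => c n * (∑ i, |x i|) ^ e n := fun n =>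
    continuous_const.mul ((continuous_finsetSum _ fun i _ => (continuous_apply i).abs).pow _)
  have hexp : ∀ (μ : Measure (ι → ℝ)) [IsProbabilityMeasure μ], μ (Set.pi Set.univ (fun _ : ι => Set.Icc (-1 : ℝ) 1))ᶜ = 0 →
      ∫ x, ∑ n ∈ range N, c n * (∑ i, |x i|) ^ e n ∂μ = ∑ n ∈ range N, c n * ∫ x, (∑ i, |x i|) ^ e n ∂μ := by
    intro μ _ hμ
    rw [integral_finsetSum _ (fun n _ => integrable_of_continuous_of_cube hμ (hcont n))]
    exact Finset.sum_congr rfl fun n _ => integral_const_mul _ _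
  rw [hexp P hP, hexp Q hQ, ← Finset.sum_sub_distrib, Finset.sum_mul]
  refine (abs_sum_le_sum_abs _ _).trans (Finset.sum_le_sum fun n _ => ?_)
  rw [← mul_sub, abs_mul, mul_assoc]
  exact mul_le_mul_of_nonneg_left (abs_integral_l1NormPow_sub_le hP hQ hr0 hr1 hmom (e n)) (abs_nonneg _)

/-- ★★ **ABSOLUTELY SUMMABLE POWER SERIES IN THE ℓ¹-NORM: `(Σ'_n|c_n|d^{e_n})·96∕(1 + log r⁻¹)`.**  `P, Q` on `[−1,1]^ι` with all mixed moments
`r`-close (`0 < r ≤ 1`), `d = |ι|`, coefficients `c : ℕ → ℝ` and exponents `e : ℕ → ℕ` with `M = Σ_n|c_n|d^{e_n} < ∞`.  Then the link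
`x ↦ Σ'_n c_n(Σ_i|x_i|)^{e_n}` (absolutely convergent on the cube) satisfies `|∫Σ' dP − ∫Σ' dQ| ≤ M·96∕(1 + log r⁻¹)` — §1's partial sums converge
to it dominatedly by `M` on the cube.  The WIENER class of the disc of radius `d`, priced by its norm; the dimension enters only through `M`. [folklore] -/
theorem abs_integral_l1NormGenSeries_sub_le {P Q : Measure (ι → ℝ)} [IsProbabilityMeasure P] [IsProbabilityMeasure Q]
    (hP : P (Set.pi Set.univ (fun _ : ι => Set.Icc (-1 : ℝ) 1))ᶜ = 0) (hQ : Q (Set.pi Set.univ (fun _ : ι => Set.Icc (-1 : ℝ) 1))ᶜ = 0)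
    {r : ℝ} (hr0 : 0 < r) (hr1 : r ≤ 1)
    (hmom : ∀ j : ι → ℕ, |∫ x, ∏ i, x i ^ j i ∂P - ∫ x, ∏ i, x i ^ j i ∂Q| ≤ r) (c : ℕ → ℝ) (e : ℕ → ℕ)
    (hc : Summable fun n => |c n| * (Fintype.card ι : ℝ) ^ e n) :
    |∫ x, (∑' n, c n * (∑ i, |x i|) ^ e n) ∂P - ∫ x, (∑' n, c n * (∑ i, |x i|) ^ e n) ∂Q| ≤
      (∑' n, |c n| * (Fintype.card ι : ℝ) ^ e n) * (96 / (1 + Real.log r⁻¹)) := by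
  set S : (ι → ℝ) → ℝ := fun x => ∑ i, |x i| with hS
  set M : ℝ := ∑' n, |c n| * (Fintype.card ι : ℝ) ^ e n with hM
  set F : ℕ → (ι → ℝ) → ℝ := fun N x => ∑ n ∈ range N, c n * S x ^ e n with hF
  have hScont : Continuous S := continuous_finsetSum _ fun i _ => (continuous_apply i).abs
  have hFcont : ∀ N, Continuous (F N) := fun N => continuous_finsetSum _ fun n _ => continuous_const.mul (hScont.pow _)
  have hS0 : ∀ x, 0 ≤ S x := fun x => Finset.sum_nonneg fun i _ => abs_nonneg _
  have hB0 : 0 ≤ 96 / (1 + Real.log r⁻¹) :=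
    div_nonneg (by norm_num) (by linarith [Real.log_nonneg ((one_le_inv₀ hr0).2 hr1)])
  -- termwise domination on the cube
  have hterm : ∀ x : ι → ℝ, (∀ i, x i ∈ Set.Icc (-1 : ℝ) 1) → ∀ n, ‖c n * S x ^ e n‖ ≤ |c n| * (Fintype.card ι : ℝ) ^ e n := by
    intro x hx n
    rw [Real.norm_eq_abs, abs_mul, abs_pow, abs_of_nonneg (hS0 x)]
    exact mul_le_mul_of_nonneg_left (pow_le_pow_left₀ (hS0 x) (l1Norm_le_card hx) _) (abs_nonneg _)
  -- the price of every partial sum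
  have hprice : ∀ N, |∫ x, F N x ∂P - ∫ x, F N x ∂Q| ≤ M * (96 / (1 + Real.log r⁻¹)) := fun N =>
    (abs_integral_l1NormGenSeries_partial_sub_le hP hQ hr0 hr1 hmom c e N).trans
      (mul_le_mul_of_nonneg_right (hc.sum_le_tsum (range N) fun n _ => by positivity) hB0)
  -- pointwise limit and domination on the cube
  have hlim : ∀ x : ι → ℝ, (∀ i, x i ∈ Set.Icc (-1 : ℝ) 1) →
      Tendsto (fun N => F N x) atTop (𝓝 (∑' n, c n * S x ^ e n)) := fun x hx =>
    (Summable.of_norm_bounded hc (hterm x hx)).hasSum.tendsto_sum_nat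
  have hbound : ∀ (N : ℕ) (x : ι → ℝ), (∀ i, x i ∈ Set.Icc (-1 : ℝ) 1) → ‖F N x‖ ≤ M := by
    intro N x hx
    calc ‖F N x‖ ≤ ∑ n ∈ range N, ‖c n * S x ^ e n‖ := norm_sum_le _ _
      _ ≤ ∑ n ∈ range N, |c n| * (Fintype.card ι : ℝ) ^ e n := Finset.sum_le_sum fun n _ => hterm x hx n
      _ ≤ M := hc.sum_le_tsum (range N) fun n _ => by positivity
  have htend : ∀ (μ : Measure (ι → ℝ)) [IsProbabilityMeasure μ], μ (Set.pi Set.univ (fun _ : ι => Set.Icc (-1 : ℝ) 1))ᶜ = 0 →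
      Tendsto (fun N => ∫ x, F N x ∂μ) atTop (𝓝 (∫ x, ∑' n, c n * S x ^ e n ∂μ)) := by
    intro μ _ hμ
    have hae : ∀ᵐ x ∂μ, x ∈ Set.pi Set.univ (fun _ : ι => Set.Icc (-1 : ℝ) 1) := mem_ae_iff.2 hμ
    exact tendsto_integral_of_dominated_convergence (fun _ => M) (fun N => (hFcont N).aestronglyMeasurable) (integrable_const _)
      (fun N => hae.mono fun x hx => hbound N x fun i => Set.mem_univ_pi.1 hx i)
      (hae.mono fun x hx => hlim x fun i => Set.mem_univ_pi.1 hx i)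
  exact le_of_tendsto' ((htend P hP).sub (htend Q hQ)).abs hprice

/-! ## §2 The single Fourier mode of the ℓ¹-norm and its relatives [folklore] -/

/-- ★★ **THE SINGLE MODE: `|∫cos(ω·Σ_i|x_i|) dP − ∫cos(ω·Σ_i|x_i|) dQ| ≤ (cosh(ωd) − 1)·96∕(1 + log r⁻¹)`** (`ω ≥ 0`; `P, Q` on `[−1,1]^ι` with all
mixed moments `r`-close, `0 < r ≤ 1`, `d = |ι|`) — §1 on `cos(ωS) − 1 = Σ_n (−1)^{n+1}(ωS)^{2n+2}∕(2n+2)!`, weighted mass `cosh(ωd) − 1`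
(`≤ (ωd)²` for `ωd ≤ 1`: quadratic in the frequency; `≈ e^{ωd}∕2` beyond).  Non-trivial while `ωd ≲ log log r⁻¹`, below module 111's
`dω∕√(log r⁻¹)` while `ωd ≲ ½ log log r⁻¹`; the regime `ωd ≫ log log r⁻¹` stays OPEN. [folklore] -/
theorem abs_integral_cos_l1Norm_sub_le {P Q : Measure (ι → ℝ)} [IsProbabilityMeasure P] [IsProbabilityMeasure Q]
    (hP : P (Set.pi Set.univ (fun _ : ι => Set.Icc (-1 : ℝ) 1))ᶜ = 0) (hQ : Q (Set.pi Set.univ (fun _ : ι => Set.Icc (-1 : ℝ) 1))ᶜ = 0)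
    {r : ℝ} (hr0 : 0 < r) (hr1 : r ≤ 1)
    (hmom : ∀ j : ι → ℕ, |∫ x, ∏ i, x i ^ j i ∂P - ∫ x, ∏ i, x i ^ j i ∂Q| ≤ r) {ω : ℝ} (hω : 0 ≤ ω) :
    |∫ x, Real.cos (ω * ∑ i, |x i|) ∂P - ∫ x, Real.cos (ω * ∑ i, |x i|) ∂Q| ≤
      (Real.cosh (ω * Fintype.card ι) - 1) * (96 / (1 + Real.log r⁻¹)) := by
  set S : (ι → ℝ) → ℝ := fun x => ∑ i, |x i| with hS
  -- the shifted cosine series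
  set c : ℕ → ℝ := fun n => (-1) ^ (n + 1) * (ω ^ (2 * (n + 1)) / ((2 * (n + 1)).factorial : ℝ)) with hc
  set e : ℕ → ℕ := fun n => 2 * (n + 1) with he
  have hseries : ∀ y : ℝ, HasSum (fun n => c n * y ^ e n) (Real.cos (ω * y) - 1) := by
    intro y
    have h := (hasSum_nat_add_iff' 1).2 (Real.hasSum_cos (ω * y))
    rw [Finset.sum_range_one] at h
    simp only [pow_zero, mul_zero, Nat.factorial_zero, Nat.cast_one, div_one, mul_one] at h
    refine h.congr_fun fun n => ?_
    simp only [hc, he, mul_pow]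
    ring
  have hmassSum : HasSum (fun n => |c n| * (Fintype.card ι : ℝ) ^ e n) (Real.cosh (ω * Fintype.card ι) - 1) := by
    have h := (hasSum_nat_add_iff' 1).2 (Real.hasSum_cosh (ω * Fintype.card ι))
    rw [Finset.sum_range_one] at h
    simp only [pow_zero, mul_zero, Nat.factorial_zero, Nat.cast_one, div_one] at h
    refine h.congr_fun fun n => ?_
    have habs : |c n| = ω ^ (2 * (n + 1)) / ((2 * (n + 1)).factorial : ℝ) := by
      simp only [hc, abs_mul, abs_pow, abs_neg, abs_one, one_pow, one_mul]
      exact abs_of_nonneg (by positivity)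
    rw [habs, he, mul_pow]
    ring
  have hkey := abs_integral_l1NormGenSeries_sub_le hP hQ hr0 hr1 hmom c e hmassSum.summable
  have hfun : (fun x : ι → ℝ => ∑' n, c n * S x ^ e n) = fun x => Real.cos (ω * S x) - 1 :=
    funext fun x => (hseries (S x)).tsum_eq
  rw [hfun, hmassSum.tsum_eq] at hkey
  -- constants are free
  have hcont : Continuous fun x : ι → ℝ => Real.cos (ω * S x) :=
    Real.continuous_cos.comp (continuous_const.mul (continuous_finsetSum _ fun i _ => (continuous_apply i).abs))
  have hsub : ∀ (μ : Measure (ι → ℝ)) [IsProbabilityMeasure μ], μ (Set.pi Set.univ (fun _ : ι => Set.Icc (-1 : ℝ) 1))ᶜ = 0 →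
      ∫ x, (Real.cos (ω * S x) - 1) ∂μ = (∫ x, Real.cos (ω * S x) ∂μ) - 1 := by
    intro μ _ hμ
    rw [integral_sub (integrable_of_continuous_of_cube hμ hcont) (integrable_const _), integral_const, probReal_univ, one_smul]
  rw [hsub P hP, hsub Q hQ] at hkey
  calc |∫ x, Real.cos (ω * S x) ∂P - ∫ x, Real.cos (ω * S x) ∂Q|
        = |((∫ x, Real.cos (ω * S x) ∂P) - 1) - ((∫ x, Real.cos (ω * S x) ∂Q) - 1)| := by ring_nf
    _ ≤ (Real.cosh (ω * Fintype.card ι) - 1) * (96 / (1 + Real.log r⁻¹)) := hkey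

/-- ★ **`|∫sin(ω·Σ_i|x_i|) dP − ∫sin(ω·Σ_i|x_i|) dQ| ≤ sinh(ωd)·96∕(1 + log r⁻¹)`** (`ω ≥ 0`; same setting) — §1 on the sine series, weighted mass
`sinh(ωd)`. [folklore] -/
theorem abs_integral_sin_l1Norm_sub_le {P Q : Measure (ι → ℝ)} [IsProbabilityMeasure P] [IsProbabilityMeasure Q]
    (hP : P (Set.pi Set.univ (fun _ : ι => Set.Icc (-1 : ℝ) 1))ᶜ = 0) (hQ : Q (Set.pi Set.univ (fun _ : ι => Set.Icc (-1 : ℝ) 1))ᶜ = 0)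
    {r : ℝ} (hr0 : 0 < r) (hr1 : r ≤ 1)
    (hmom : ∀ j : ι → ℕ, |∫ x, ∏ i, x i ^ j i ∂P - ∫ x, ∏ i, x i ^ j i ∂Q| ≤ r) {ω : ℝ} (hω : 0 ≤ ω) :
    |∫ x, Real.sin (ω * ∑ i, |x i|) ∂P - ∫ x, Real.sin (ω * ∑ i, |x i|) ∂Q| ≤
      Real.sinh (ω * Fintype.card ι) * (96 / (1 + Real.log r⁻¹)) := by
  set S : (ι → ℝ) → ℝ := fun x => ∑ i, |x i| with hS
  set c : ℕ → ℝ := fun n => (-1) ^ n * (ω ^ (2 * n + 1) / ((2 * n + 1).factorial : ℝ)) with hc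
  set e : ℕ → ℕ := fun n => 2 * n + 1 with he
  have hseries : ∀ y : ℝ, HasSum (fun n => c n * y ^ e n) (Real.sin (ω * y)) := by
    intro y
    refine (Real.hasSum_sin (ω * y)).congr_fun fun n => ?_
    simp only [hc, he, mul_pow]
    ring
  have hmassSum : HasSum (fun n => |c n| * (Fintype.card ι : ℝ) ^ e n) (Real.sinh (ω * Fintype.card ι)) := by
    refine (Real.hasSum_sinh (ω * Fintype.card ι)).congr_fun fun n => ?_
    have habs : |c n| = ω ^ (2 * n + 1) / ((2 * n + 1).factorial : ℝ) := by
      simp only [hc, abs_mul, abs_pow, abs_neg, abs_one, one_pow, one_mul]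
      exact abs_of_nonneg (by positivity)
    rw [habs, he, mul_pow]
    ring
  have hkey := abs_integral_l1NormGenSeries_sub_le hP hQ hr0 hr1 hmom c e hmassSum.summable
  have hfun : (fun x : ι → ℝ => ∑' n, c n * S x ^ e n) = fun x => Real.sin (ω * S x) :=
    funext fun x => (hseries (S x)).tsum_eq
  rwa [hfun, hmassSum.tsum_eq] at hkey

/-- ★ **`|∫exp(t·Σ_i|x_i|) dP − ∫exp(t·Σ_i|x_i|) dQ| ≤ (e^{|t|d} − 1)·96∕(1 + log r⁻¹)` for EVERY real `t`** (same setting) — §1 on the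
exponential series minus its constant term, weighted mass `e^{|t|d} − 1` (module 115 §5 is the case `t ≥ 0`). [folklore] -/
theorem abs_integral_exp_l1Norm_sub_le_of_real {P Q : Measure (ι → ℝ)} [IsProbabilityMeasure P] [IsProbabilityMeasure Q]
    (hP : P (Set.pi Set.univ (fun _ : ι => Set.Icc (-1 : ℝ) 1))ᶜ = 0) (hQ : Q (Set.pi Set.univ (fun _ : ι => Set.Icc (-1 : ℝ) 1))ᶜ = 0)
    {r : ℝ} (hr0 : 0 < r) (hr1 : r ≤ 1)
    (hmom : ∀ j : ι → ℕ, |∫ x, ∏ i, x i ^ j i ∂P - ∫ x, ∏ i, x i ^ j i ∂Q| ≤ r) (t : ℝ) :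
    |∫ x, Real.exp (t * ∑ i, |x i|) ∂P - ∫ x, Real.exp (t * ∑ i, |x i|) ∂Q| ≤
      (Real.exp (|t| * Fintype.card ι) - 1) * (96 / (1 + Real.log r⁻¹)) := by
  set S : (ι → ℝ) → ℝ := fun x => ∑ i, |x i| with hS
  set c : ℕ → ℝ := fun n => t ^ (n + 1) / ((n + 1).factorial : ℝ) with hc
  set e : ℕ → ℕ := fun n => n + 1 with he
  have hexpSum : ∀ y : ℝ, HasSum (fun n : ℕ => y ^ n / (n.factorial : ℝ)) (Real.exp y) := fun y => by
    rw [Real.exp_eq_exp_ℝ]; exact NormedSpace.expSeries_div_hasSum_exp y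
  have hseries : ∀ y : ℝ, HasSum (fun n => c n * y ^ e n) (Real.exp (t * y) - 1) := by
    intro y
    have h := (hasSum_nat_add_iff' 1).2 (hexpSum (t * y))
    rw [Finset.sum_range_one] at h
    simp only [pow_zero, Nat.factorial_zero, Nat.cast_one, div_one] at h
    refine h.congr_fun fun n => ?_
    simp only [hc, he, mul_pow]
    ring
  have hmassSum : HasSum (fun n => |c n| * (Fintype.card ι : ℝ) ^ e n) (Real.exp (|t| * Fintype.card ι) - 1) := by
    have h := (hasSum_nat_add_iff' 1).2 (hexpSum (|t| * Fintype.card ι))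
    rw [Finset.sum_range_one] at h
    simp only [pow_zero, Nat.factorial_zero, Nat.cast_one, div_one] at h
    refine h.congr_fun fun n => ?_
    have habs : |c n| = |t| ^ (n + 1) / ((n + 1).factorial : ℝ) := by
      simp only [hc, abs_div, abs_pow, Nat.abs_cast]
    rw [habs, he, mul_pow]
    ring
  have hkey := abs_integral_l1NormGenSeries_sub_le hP hQ hr0 hr1 hmom c e hmassSum.summable
  have hfun : (fun x : ι → ℝ => ∑' n, c n * S x ^ e n) = fun x => Real.exp (t * S x) - 1 :=
    funext fun x => (hseries (S x)).tsum_eq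
  rw [hfun, hmassSum.tsum_eq] at hkey
  have hcont : Continuous fun x : ι → ℝ => Real.exp (t * S x) :=
    Real.continuous_exp.comp (continuous_const.mul (continuous_finsetSum _ fun i _ => (continuous_apply i).abs))
  have hsub : ∀ (μ : Measure (ι → ℝ)) [IsProbabilityMeasure μ], μ (Set.pi Set.univ (fun _ : ι => Set.Icc (-1 : ℝ) 1))ᶜ = 0 →
      ∫ x, (Real.exp (t * S x) - 1) ∂μ = (∫ x, Real.exp (t * S x) ∂μ) - 1 := by
    intro μ _ hμ
    rw [integral_sub (integrable_of_continuous_of_cube hμ hcont) (integrable_const _), integral_const, probReal_univ, one_smul]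
  rw [hsub P hP, hsub Q hQ] at hkey
  calc |∫ x, Real.exp (t * S x) ∂P - ∫ x, Real.exp (t * S x) ∂Q|
        = |((∫ x, Real.exp (t * S x) ∂P) - 1) - ((∫ x, Real.exp (t * S x) ∂Q) - 1)| := by ring_nf
    _ ≤ (Real.exp (|t| * Fintype.card ι) - 1) * (96 / (1 + Real.log r⁻¹)) := hkey

/-! ## §3 Tensor products of absolutely monotone absolute profiles are priced by their oscillation, dimension-free [folklore] -/

open Summit.QuantumFields.YangMills.Theorems.BalabanUVNodesN19JointLawPriceAbsolutePolynomials (abs_integral_prodAbsPow_sub_le) in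
/-- ★★ **`∏_i g_i(|x_i|)` WITH ABSOLUTELY MONOTONE POLYNOMIAL PROFILES: `(∏_i g_i(1) − ∏_i g_i(0))·96∕(1 + log r⁻¹)`.**  `P, Q` on `[−1,1]^ι`
with all mixed moments `r`-close (`0 < r ≤ 1`); `g_i` real polynomials of degree `≤ D` with NONNEGATIVE coefficients.  Then
`|∫∏_i g_i(|x_i|) dP − ∫∏_i g_i(|x_i|) dQ| ≤ (∏_i g_i(1) − ∏_i g_i(0))·96∕(1 + log r⁻¹)`: the product expands into mixed ABSOLUTE moments with
nonnegative weights of total `∏_i g_i(1)` (module 115 §2 prices each at `96∕(1+L)`); the constant term `∏_i g_i(0)` is free.  E.g.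
`∏_i(1 + |x_i|)∕2` costs `(1 − 2^{−d})·96∕(1+L)` — a product of `d` kinked one-string factors at the ONE-string rate, against `≍ d²∕L` by the tensor
scheme of module 65. [folklore] -/
theorem abs_integral_prodAbsProfile_sub_le {P Q : Measure (ι → ℝ)} [IsProbabilityMeasure P] [IsProbabilityMeasure Q]
    (hP : P (Set.pi Set.univ (fun _ : ι => Set.Icc (-1 : ℝ) 1))ᶜ = 0) (hQ : Q (Set.pi Set.univ (fun _ : ι => Set.Icc (-1 : ℝ) 1))ᶜ = 0)
    {r : ℝ} (hr0 : 0 < r) (hr1 : r ≤ 1)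
    (hmom : ∀ j : ι → ℕ, |∫ x, ∏ i, x i ^ j i ∂P - ∫ x, ∏ i, x i ^ j i ∂Q| ≤ r) (g : ι → Polynomial ℝ) {D : ℕ}
    (hD : ∀ i, (g i).natDegree ≤ D) (hg : ∀ i p, 0 ≤ (g i).coeff p) :
    |∫ x, ∏ i, (g i).eval |x i| ∂P - ∫ x, ∏ i, (g i).eval |x i| ∂Q| ≤
      ((∏ i, (g i).eval 1) - ∏ i, (g i).eval 0) * (96 / (1 + Real.log r⁻¹)) := by
  classical
  set T : Finset (ι → ℕ) := Fintype.piFinset fun _ : ι => range (D + 1) with hT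
  -- expansion of the product into weighted absolute monomials
  have hexpand : ∀ y : ι → ℝ, ∏ i, (g i).eval (y i) = ∑ f ∈ T, (∏ i, (g i).coeff (f i)) * ∏ i, y i ^ f i := by
    intro y
    have h1 : ∏ i, (g i).eval (y i) = ∏ i, ∑ p ∈ range (D + 1), (g i).coeff p * y i ^ p :=
      Finset.prod_congr rfl fun i _ => Polynomial.eval_eq_sum_range' (Nat.lt_succ_of_le (hD i)) _
    rw [h1, Finset.prod_univ_sum (fun _ : ι => range (D + 1)) (fun i p => (g i).coeff p * y i ^ p)]
    exact Finset.sum_congr rfl fun f _ => Finset.prod_mul_distrib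
  have hcont : ∀ f : ι → ℕ, Continuous fun x : ι → ℝ => (∏ i, (g i).coeff (f i)) * ∏ i, |x i| ^ f i := fun f =>
    continuous_const.mul (continuous_finsetProd _ fun i _ => (continuous_apply i).abs.pow _)
  have hint : ∀ (μ : Measure (ι → ℝ)) [IsProbabilityMeasure μ], μ (Set.pi Set.univ (fun _ : ι => Set.Icc (-1 : ℝ) 1))ᶜ = 0 →
      ∫ x, ∏ i, (g i).eval |x i| ∂μ = ∑ f ∈ T, (∏ i, (g i).coeff (f i)) * ∫ x, ∏ i, |x i| ^ f i ∂μ := by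
    intro μ _ hμ
    have hfun : (fun x : ι → ℝ => ∏ i, (g i).eval |x i|) = fun x => ∑ f ∈ T, (∏ i, (g i).coeff (f i)) * ∏ i, |x i| ^ f i := by
      funext x; exact hexpand fun i => |x i|
    rw [hfun, integral_finsetSum _ (fun f _ => integrable_of_continuous_of_cube hμ (hcont f))]
    exact Finset.sum_congr rfl fun f _ => integral_const_mul _ _
  -- the weights: nonnegative, total `∏ g_i(1)`, constant term `∏ g_i(0)`
  have hw0 : ∀ f : ι → ℕ, 0 ≤ ∏ i, (g i).coeff (f i) := fun f => Finset.prod_nonneg fun i _ => hg i (f i)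
  have hwsum : ∑ f ∈ T, ∏ i, (g i).coeff (f i) = ∏ i, (g i).eval 1 := by
    rw [hT, ← Finset.prod_univ_sum (fun _ : ι => range (D + 1)) (fun i p => (g i).coeff p)]
    refine Finset.prod_congr rfl fun i _ => ?_
    rw [Polynomial.eval_eq_sum_range' (Nat.lt_succ_of_le (hD i)) (1 : ℝ)]
    exact Finset.sum_congr rfl fun p _ => by rw [one_pow, mul_one]
  have hzero_mem : (fun _ : ι => (0 : ℕ)) ∈ T := Fintype.mem_piFinset.2 fun _ => mem_range.2 (Nat.succ_pos D)
  have hwzero : (∏ i, (g i).coeff ((fun _ : ι => (0 : ℕ)) i)) = ∏ i, (g i).eval 0 :=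
    Finset.prod_congr rfl fun i _ => Polynomial.coeff_zero_eq_eval_zero _
  have hconst : (∫ x, ∏ i, |x i| ^ (fun _ : ι => (0 : ℕ)) i ∂P) - ∫ x, ∏ i, |x i| ^ (fun _ : ι => (0 : ℕ)) i ∂Q = 0 := by
    simp only [pow_zero, Finset.prod_const_one, integral_const, probReal_univ, one_smul, sub_self]
  have herase : ∑ f ∈ T.erase (fun _ : ι => (0 : ℕ)), ∏ i, (g i).coeff (f i) = (∏ i, (g i).eval 1) - ∏ i, (g i).eval 0 := by
    rw [Finset.sum_erase_eq_sub hzero_mem, hwsum, hwzero]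
  -- assemble
  have hdiff : (∫ x, ∏ i, (g i).eval |x i| ∂P) - ∫ x, ∏ i, (g i).eval |x i| ∂Q =
      ∑ f ∈ T.erase (fun _ : ι => (0 : ℕ)),
        (∏ i, (g i).coeff (f i)) * ((∫ x, ∏ i, |x i| ^ f i ∂P) - ∫ x, ∏ i, |x i| ^ f i ∂Q) := by
    rw [hint P hP, hint Q hQ, ← Finset.sum_sub_distrib, ← Finset.add_sum_erase T _ hzero_mem, ← mul_sub, hconst, mul_zero, zero_add]
    exact Finset.sum_congr rfl fun f _ => (mul_sub _ _ _).symm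
  rw [hdiff]
  calc |∑ f ∈ T.erase (fun _ : ι => (0 : ℕ)), (∏ i, (g i).coeff (f i)) * ((∫ x, ∏ i, |x i| ^ f i ∂P) - ∫ x, ∏ i, |x i| ^ f i ∂Q)|
      ≤ ∑ f ∈ T.erase (fun _ : ι => (0 : ℕ)), |(∏ i, (g i).coeff (f i)) * ((∫ x, ∏ i, |x i| ^ f i ∂P) - ∫ x, ∏ i, |x i| ^ f i ∂Q)| :=
        abs_sum_le_sum_abs _ _
    _ ≤ ∑ f ∈ T.erase (fun _ : ι => (0 : ℕ)), (∏ i, (g i).coeff (f i)) * (96 / (1 + Real.log r⁻¹)) :=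
        Finset.sum_le_sum fun f _ => by
          rw [abs_mul, abs_of_nonneg (hw0 f)]
          exact mul_le_mul_of_nonneg_left (abs_integral_prodAbsPow_sub_le hP hQ hr0 hr1 hmom f) (hw0 f)
    _ = ((∏ i, (g i).eval 1) - ∏ i, (g i).eval 0) * (96 / (1 + Real.log r⁻¹)) := by rw [← Finset.sum_mul, herase]

/-! ## §4 At the scheme: the single mode of `d` strings under the uniform target [bookkeeping] -/

section AtScheme

open Literature.MathematicalPhysics.QuantumFieldTheory.Balaban1983to89
open T4GenFunBounds (prodObs gibbsMeasure schemeZ)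
open Missing (TorusScheme)
open Summit.QuantumFields.BalabanUV.T4Continuum.Spine
open Summit.QuantumFields.YangMills.Theorems.BalabanUVNodesN19JointLawClosedFormAtScheme (jointLaw_pushforward)

variable {G : Type*} [GaugeGroup G] [MeasurableSpace G] [RegularGaugeGroup G] [HaarData G] {O : Type*}
  (S : TorusScheme G O) (hβ : ∀ K, 0 ≤ S.β K) (hm : ∀ K o, Measurable (S.obs K o)) (h1 : ∀ K o U, |S.obs K o U| ≤ 1)
include hβ hm h1

/-- ★ **THE SINGLE MODE OF `d` STRINGS AT THE SCHEME: `(cosh(ωd) − 1)·96∕(1 + log R_K⁻¹)`.**  Under `Spine.NE7.Target vol l₀ δ (schemeZ S os)` for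
EVERY string (`0 < l₀`), for a finite family `os : ι → List O` with a continuum joint law `ν` on `[−1,1]^ι` receiving all continuous functionals,
a frequency `ω ≥ 0`, and every step `K` at which `R_K = (4e^{1+l₀}∕l₀)·τ_K·(1 + log⁺τ_K⁻¹) ∈ (0, 1]`:
`|∫ cos(ω·Σ_i|∏os_i|) dgibbs_K − ∫ cos(ω·Σ_i|x_i|) dν| ≤ (cosh(ωd) − 1)·96∕(1 + log R_K⁻¹)` (§2 at `r = R_K` on module 67's push-forward).
CONDITIONAL on the uniform `Target`; nothing of Bałaban's instantiated. [bookkeeping] -/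
theorem abs_integral_cos_l1Norm_sub_jointLaw_le_of_uniformTarget {vol l₀ : ℝ} {δ : ℕ → ℝ}
    (hl₀ : 0 < l₀) (hT : ∀ os : List O, NE7.Target vol l₀ δ (schemeZ S os)) (os : ι → List O) (ν : Measure (ι → ℝ)) [IsProbabilityMeasure ν]
    (hν1 : ν (Set.pi Set.univ (fun _ : ι => Set.Icc (-1 : ℝ) 1))ᶜ = 0)
    (hν : ∀ f : (ι → ℝ) → ℝ, Continuous f →
      Tendsto (fun K => ∫ U, f (fun i => prodObs S K (os i) U) ∂gibbsMeasure (S.P K) (S.β K)) atTop (𝓝 (∫ x, f x ∂ν)))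
    {ω : ℝ} (hω : 0 ≤ ω) (K : ℕ)
    (hR0 : 0 < 4 * Real.exp (1 + l₀) / l₀ * (∑' j, 2 * (vol * δ (K + j))) * (1 + Real.posLog (∑' j, 2 * (vol * δ (K + j)))⁻¹))
    (hR1 : 4 * Real.exp (1 + l₀) / l₀ * (∑' j, 2 * (vol * δ (K + j))) * (1 + Real.posLog (∑' j, 2 * (vol * δ (K + j)))⁻¹) ≤ 1) :
    |∫ U, Real.cos (ω * ∑ i, |prodObs S K (os i) U|) ∂gibbsMeasure (S.P K) (S.β K) - ∫ x, Real.cos (ω * ∑ i, |x i|) ∂ν| ≤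
      (Real.cosh (ω * Fintype.card ι) - 1) *
        (96 / (1 + Real.log (4 * Real.exp (1 + l₀) / l₀ * (∑' j, 2 * (vol * δ (K + j))) * (1 + Real.posLog (∑' j, 2 * (vol * δ (K + j)))⁻¹))⁻¹)) := by
  obtain ⟨P, iP, hPc, hint, -, hmom⟩ := jointLaw_pushforward S hβ hm h1 hl₀ hT os ν hν K
  have hc : Continuous fun x : ι → ℝ => Real.cos (ω * ∑ i, |x i|) :=
    Real.continuous_cos.comp (continuous_const.mul (continuous_finsetSum _ fun i _ => (continuous_apply i).abs))
  rw [← hint hc]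
  exact abs_integral_cos_l1Norm_sub_le hPc hν1 hR0 hR1 hmom hω

/-- ★ **TENSOR PRODUCTS OF ABSOLUTELY MONOTONE ABSOLUTE PROFILES OF `d` STRINGS AT THE SCHEME: `(∏_i g_i(1) − ∏_i g_i(0))·96∕(1 + log R_K⁻¹)`.**
In the setting of `abs_integral_cos_l1Norm_sub_jointLaw_le_of_uniformTarget`, for polynomials `g_i` of degree `≤ D` with nonnegative coefficients:
`|∫ ∏_i g_i(|∏os_i|) dgibbs_K − ∫ ∏_i g_i(|x_i|) dν| ≤ (∏_i g_i(1) − ∏_i g_i(0))·96∕(1 + log R_K⁻¹)` (§3 at `r = R_K`).  CONDITIONAL on the uniform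
`Target`; nothing of Bałaban's instantiated. [bookkeeping] -/
theorem abs_integral_prodAbsProfile_sub_jointLaw_le_of_uniformTarget {vol l₀ : ℝ} {δ : ℕ → ℝ}
    (hl₀ : 0 < l₀) (hT : ∀ os : List O, NE7.Target vol l₀ δ (schemeZ S os)) (os : ι → List O) (ν : Measure (ι → ℝ)) [IsProbabilityMeasure ν]
    (hν1 : ν (Set.pi Set.univ (fun _ : ι => Set.Icc (-1 : ℝ) 1))ᶜ = 0)
    (hν : ∀ f : (ι → ℝ) → ℝ, Continuous f →
      Tendsto (fun K => ∫ U, f (fun i => prodObs S K (os i) U) ∂gibbsMeasure (S.P K) (S.β K)) atTop (𝓝 (∫ x, f x ∂ν)))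
    (g : ι → Polynomial ℝ) {D : ℕ} (hD : ∀ i, (g i).natDegree ≤ D) (hg : ∀ i p, 0 ≤ (g i).coeff p) (K : ℕ)
    (hR0 : 0 < 4 * Real.exp (1 + l₀) / l₀ * (∑' j, 2 * (vol * δ (K + j))) * (1 + Real.posLog (∑' j, 2 * (vol * δ (K + j)))⁻¹))
    (hR1 : 4 * Real.exp (1 + l₀) / l₀ * (∑' j, 2 * (vol * δ (K + j))) * (1 + Real.posLog (∑' j, 2 * (vol * δ (K + j)))⁻¹) ≤ 1) :
    |∫ U, ∏ i, (g i).eval |prodObs S K (os i) U| ∂gibbsMeasure (S.P K) (S.β K) - ∫ x, ∏ i, (g i).eval |x i| ∂ν| ≤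
      ((∏ i, (g i).eval 1) - ∏ i, (g i).eval 0) *
        (96 / (1 + Real.log (4 * Real.exp (1 + l₀) / l₀ * (∑' j, 2 * (vol * δ (K + j))) * (1 + Real.posLog (∑' j, 2 * (vol * δ (K + j)))⁻¹))⁻¹)) := by
  obtain ⟨P, iP, hPc, hint, -, hmom⟩ := jointLaw_pushforward S hβ hm h1 hl₀ hT os ν hν K
  have hc : Continuous fun x : ι → ℝ => ∏ i, (g i).eval |x i| :=
    continuous_finsetProd _ fun i _ => (Polynomial.continuous _).comp (continuous_apply i).abs
  rw [← hint hc]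
  exact abs_integral_prodAbsProfile_sub_le hPc hν1 hR0 hR1 hmom g hD hg

end AtScheme

end Summit.QuantumFields.YangMills.Theorems.BalabanUVNodesN19JointLawPriceAbsolutePowerSeries

end
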